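import Summits.Ventures.Crystal3D.Theorems.StickyWulffConstantGenericWallFloorSaturatedPocket
import Summits.Ventures.Crystal3D.Theorems.StickyWulffConstantGenericWallFloorSlotDozens
import HarnessLib

/-!
# Payer-or-docked at an END BALL, and RIGID DOCKING: a docked end ball sharing three independent slot
# neighbours with the docking dozen sits at an exact slot site (crux `GenericWallFloor`, stmt-Ventures-19480, line `WallLedgerG`)

HONEST FRAMING. Venture `Summits/Ventures/Crystal3D` (cell `crystal3d-full`), helper `--supports` the crux
`GenericWallFloor` of `route-Ventures-StickyWulffConstant`, REGISTERED line `WallLedgerG`, open stub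
`stub_twoSlabAdhesion`.  Rung credit only; F-C1 not moved; NOT the crux.  Census-free, standard axioms; the kissing facts
`KissingGap δ`, `KissingClassification δ` (`δ ≥ 5/2`) enter §1 as hypotheses exactly like `…SaturationStructure`.

Sequel of `…SaturatedPocket` (memo STRUCTURAL-GLUE-g10 §3 on the item, items (G-c)/(G-c′) of cf-p1 DECISION (xlii)):
* §1 **`payer_near_or_docked_of_near_endBall`** — the foreign-ball dichotomy RE-ANCHORED AT THE END BALL `z`: for every
  other ball `x ∈ X` within `√3` of `z` (contact or not), EITHER some ball `y ≠ z` with `dist x y ≤ 2` has at most eleven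
  contacts, OR `z` is DOCKED near `x`: some `s ∈ X` with `dist x s ≤ 1`, `dist s z = 1`, twelve contacts and a complete
  close-packed dozen `{s + B p}` (fcc or hcp pattern) through `z`, with `x = s` or `x` in that dozen.  (Contact case
  `dist x z = 1`: all-but-one classification at `x` itself; non-contact case: `unsaturated_near_or_docked_of_saturated`.)
* §2 **RIGID DOCKING, fcc type: `docked_fcc_exact`** — if `z` is docked on `s` whose contacts are exactly an fcc dozen
  `{s + B p}`, and three slot neighbours `z + A wᵢ ∈ X` of `z`'s grain frame `A` (`wᵢ ∈ fccSlots` linearly independent) touch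
  `s`, then `B(fccKissingPattern) = A(fccSlots)` and `s = z + A w₀` for a slot `w₀`: the docking ball, and with it its whole
  dozen (`mem_slot_shell_of_docked_fcc`: every contact of `s` is `z + A w₀ + A w`), sit at EXACT slot positions of the walking
  grain — the «exact branch» of the glue is exact IN THE GRAIN FRAME.  Mechanism: the fcc dozen of `s` is the unit shell of a
  rigid lattice `A₂·Λ₀` (`exists_frame_of_fccDozen`), the three touching slot neighbours give three independent common unit
  vectors `A wᵢ = A₂(uᵢ − u₀)` of `A·Λ₀` and `A₂·Λ₀`, and `movedFcc_eq_of_three_independent_slots` (…DozenRigidity).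
WHAT THIS IS NOT: the hcp-type docking dozen (twin dozens; the shared differences then live in one of two fcc halves — to do,
(G-c″)), the COUNT supplying the three shared neighbours (`k + 5 − deg z ≥ 3` for `k` certified slot neighbours, memo §3(3)),
no ledger; F-C1 not moved.
-/

noncomputable section

namespace Summit.Ventures.Crystal3D.Theorems

open Summit.Ventures.Crystal3D Finset
open Literature.Geometry.DiscreteGeometry (fccKissingPattern hcpKissingPattern IsArrangedIn)
open Literature.MathematicalPhysics.StatisticalMechanics (fccStacking)
open scoped InnerProductSpace

variable {X : Finset (EuclideanSpace ℝ (Fin 3))}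

/-! ### §1 The dichotomy anchored at the end ball -/

/-- **Payer-or-docked at an end ball.**  Under GAP(`δ`) ∧ CLASSIFICATION(`δ`), `δ ≥ 5/2`: `z ∈ X` (the end ball), `x ∈ X`,
`x ≠ z`, `dist x z ≤ √3`.  Then EITHER some `y ∈ X`, `y ≠ z`, `dist x y ≤ 2`, has at most eleven contacts, OR there are
`s ∈ X`, a pattern `P` (fcc or hcp) and a linear isometry `B` with `dist x s ≤ 1`, `dist s z = 1`, `s` twelve-touched, the
dozen `{s + B p : p ∈ P}` inside `X`, `z = s + B p′`, and `x = s` or `x = s + B p″`. -/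
theorem payer_near_or_docked_of_near_endBall {δ : ℝ} (hg : KissingGap δ) (hc : KissingClassification δ)
    (hδ : 5 / 2 ≤ δ) (hX : ∀ p ∈ X, ∀ q ∈ X, p ≠ q → 1 ≤ dist p q)
    {z : EuclideanSpace ℝ (Fin 3)} (hz : z ∈ X) {x : EuclideanSpace ℝ (Fin 3)} (hx : x ∈ X) (hxz : x ≠ z)
    (h3 : dist x z ≤ Real.sqrt 3) :
    (∃ y ∈ X, y ≠ z ∧ dist x y ≤ 2 ∧ (X.filter fun q => dist y q = 1).card ≤ 11) ∨
    ∃ s ∈ X, ∃ (P : Finset (EuclideanSpace ℝ (Fin 3))) (B : EuclideanSpace ℝ (Fin 3) →ₗᵢ[ℝ] EuclideanSpace ℝ (Fin 3)),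
      (P = fccKissingPattern ∨ P = hcpKissingPattern) ∧ dist x s ≤ 1 ∧ dist s z = 1 ∧
      (X.filter fun q => dist s q = 1).card = 12 ∧ (∀ p ∈ P, s + B p ∈ X) ∧
      (∃ p ∈ P, z = s + B p) ∧ (x = s ∨ ∃ p ∈ P, x = s + B p) := by
  classical
  have hle12 := card_filter_dist_eq_one_le_twelve X hX x
  by_cases h12 : (X.filter fun q => dist x q = 1).card = 12
  · have h1 : 1 ≤ dist x z := hX x hx z hz hxz
    rcases h1.eq_or_lt with h1 | h1
    · -- contact: all-but-one classification at `x` with the exception `z`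
      by_cases hnb : ∀ y ∈ X, dist x y = 1 → y ≠ z → (X.filter fun q => dist y q = 1).card = 12
      · right
        obtain ⟨P, B, hP, hocc, hall⟩ := exists_frame_of_allButOne hg hc hX h12 z hnb
        exact ⟨x, hx, P, B, hP, by rw [dist_self]; norm_num, h1.symm, h12, fun p hp => (hocc p hp).1,
          hall z hz h1.symm, Or.inl rfl⟩
      · left
        push Not at hnb
        obtain ⟨y, hy, hxy, hyz, hy12⟩ := hnb
        have := card_filter_dist_eq_one_le_twelve X hX y
        exact ⟨y, hy, hyz, by rw [hxy]; norm_num, by omega⟩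
    · -- non-contact: the foreign-ball dichotomy at `x`
      rcases unsaturated_near_or_docked_of_saturated hg hc hδ hX hx h12 hz h1 h3 with h | h
      · exact Or.inl h
      · right
        obtain ⟨s, hs, P, B, hP, hxs, hsz, hs12, hocc, hzB, hxB⟩ := h
        exact ⟨s, hs, P, B, hP, hxs.le, hsz, hs12, hocc, hzB, Or.inr hxB⟩
  · exact Or.inl ⟨x, hx, hxz, by rw [dist_self]; norm_num, by omega⟩

/-! ### §2 Rigid docking, fcc type -/

/-- **RIGID DOCKING (fcc type).**  `A` a grain frame; `z, s ∈ X` with `dist s z = 1`; the contacts of `s` are EXACTLY the fcc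
dozen `{s + B p}` (`hocc`, `hall` — the output of `exists_frame_of_allButOne`); and three slot neighbours `z + A wᵢ ∈ X` of `z`,
`wᵢ ∈ fccSlots` linearly independent, touch `s`.  Then the dozen of `s` IS the slot dozen of the grain, `B(fccKP) = A(fccSlots)`,
and `s = z + A w₀` for some slot `w₀`. -/
theorem docked_fcc_exact (A : EuclideanSpace ℝ (Fin 3) ≃ₗᵢ[ℝ] EuclideanSpace ℝ (Fin 3))
    {z s : EuclideanSpace ℝ (Fin 3)} (hz : z ∈ X)
    (B : EuclideanSpace ℝ (Fin 3) →ₗᵢ[ℝ] EuclideanSpace ℝ (Fin 3))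
    (hall : ∀ q ∈ X, dist s q = 1 → ∃ p ∈ fccKissingPattern, q = s + B p) (hsz : dist s z = 1)
    {w₁ w₂ w₃ : EuclideanSpace ℝ (Fin 3)} (hw₁ : w₁ ∈ fccSlots) (hw₂ : w₂ ∈ fccSlots) (hw₃ : w₃ ∈ fccSlots)
    (hind : LinearIndependent ℝ ![w₁, w₂, w₃])
    (hX₁ : z + A w₁ ∈ X) (hX₂ : z + A w₂ ∈ X) (hX₃ : z + A w₃ ∈ X)
    (hd₁ : dist s (z + A w₁) = 1) (hd₂ : dist s (z + A w₂) = 1) (hd₃ : dist s (z + A w₃) = 1) :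
    B '' (↑fccKissingPattern : Set (EuclideanSpace ℝ (Fin 3))) = A '' (↑fccSlots : Set (EuclideanSpace ℝ (Fin 3))) ∧
      ∃ w₀ ∈ fccSlots, s = z + A w₀ := by
  obtain ⟨A₂, hA₂⟩ := exists_frame_of_fccDozen B
  rw [← image_fccSlots_eq_units] at hA₂
  -- every dozen vector `B p` is a slot `A₂ u` of the rigid lattice `A₂·Λ₀`
  have toSlot : ∀ p ∈ fccKissingPattern, ∃ u ∈ fccSlots, B p = A₂ u := by
    intro p hp
    have : B p ∈ A₂ '' (↑fccSlots : Set (EuclideanSpace ℝ (Fin 3))) := by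
      rw [← hA₂]; exact ⟨p, Finset.mem_coe.2 hp, rfl⟩
    obtain ⟨u, hu, he⟩ := this
    exact ⟨u, Finset.mem_coe.1 hu, he.symm⟩
  obtain ⟨p₀, hp₀, hzp⟩ := hall z hz hsz
  obtain ⟨u₀, hu₀, hBu₀⟩ := toSlot p₀ hp₀
  -- a touching slot neighbour `z + A w` gives the common unit vector `A w = A₂ (u − u₀)`
  have common : ∀ w ∈ fccSlots, z + A w ∈ X → dist s (z + A w) = 1 →
      A w ∈ A₂ '' fccStacking 1 (Real.sqrt (2 / 3)) := by
    intro w hw hwX hwd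
    obtain ⟨p, hp, hqp⟩ := hall _ hwX hwd
    obtain ⟨u, hu, hBu⟩ := toSlot p hp
    have hAw : A w = A₂ (u - u₀) := by
      have h1 : A w = (z + A w) - z := by abel
      rw [h1, hqp, hzp, hBu, hBu₀, map_sub]; abel
    have hduu : dist u₀ u = 1 := by
      have h2 : dist u₀ u = ‖A₂ (u - u₀)‖ := by
        rw [dist_comm, dist_eq_norm, LinearIsometryEquiv.norm_map]
      rw [h2, ← hAw, LinearIsometryEquiv.norm_map, norm_eq_one_of_mem_fccSlots hw]
    have hslot : u - u₀ ∈ fccSlots :=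
      sub_mem_fccSlots_of_dist_eq_one (mem_fcc_of_mem_fccSlots hu₀) (mem_fcc_of_mem_fccSlots hu) hduu
    rw [hAw]
    exact ⟨u - u₀, mem_fcc_of_mem_fccSlots hslot, rfl⟩
  have hlat : A '' fccStacking 1 (Real.sqrt (2 / 3)) = A₂ '' fccStacking 1 (Real.sqrt (2 / 3)) :=
    movedFcc_eq_of_three_independent_slots A A₂ hw₁ hw₂ hw₃ (common w₁ hw₁ hX₁ hd₁) (common w₂ hw₂ hX₂ hd₂)
      (common w₃ hw₃ hX₃ hd₃) hind
  have hshell : A '' (↑fccSlots : Set (EuclideanSpace ℝ (Fin 3))) = A₂ '' (↑fccSlots : Set (EuclideanSpace ℝ (Fin 3))) := by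
    rw [image_fccSlots_eq_units, image_fccSlots_eq_units, hlat]
  have hBA : B '' (↑fccKissingPattern : Set (EuclideanSpace ℝ (Fin 3))) =
      A '' (↑fccSlots : Set (EuclideanSpace ℝ (Fin 3))) := by rw [hA₂, hshell]
  refine ⟨hBA, ?_⟩
  -- `s − z = B(−p₀)` is a dozen vector, hence a slot of `A`
  have hmem : B (-p₀) ∈ A '' (↑fccSlots : Set (EuclideanSpace ℝ (Fin 3))) := by
    rw [← hBA]; exact ⟨-p₀, Finset.mem_coe.2 (neg_mem_fccKissingPattern hp₀), rfl⟩
  obtain ⟨w₀, hw₀, hAw₀⟩ := hmem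
  refine ⟨w₀, Finset.mem_coe.1 hw₀, ?_⟩
  rw [hAw₀, map_neg, hzp]; abel

/-- **Every contact of the docking ball is at an exact slot position of the grain.**  Under the hypotheses of
`docked_fcc_exact`: every `q ∈ X` touching `s` is `q = z + A w₀ + A w` with `w₀, w` slots. -/
theorem mem_slot_shell_of_docked_fcc (A : EuclideanSpace ℝ (Fin 3) ≃ₗᵢ[ℝ] EuclideanSpace ℝ (Fin 3))
    {z s : EuclideanSpace ℝ (Fin 3)} (hz : z ∈ X)
    (B : EuclideanSpace ℝ (Fin 3) →ₗᵢ[ℝ] EuclideanSpace ℝ (Fin 3))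
    (hall : ∀ q ∈ X, dist s q = 1 → ∃ p ∈ fccKissingPattern, q = s + B p) (hsz : dist s z = 1)
    {w₁ w₂ w₃ : EuclideanSpace ℝ (Fin 3)} (hw₁ : w₁ ∈ fccSlots) (hw₂ : w₂ ∈ fccSlots) (hw₃ : w₃ ∈ fccSlots)
    (hind : LinearIndependent ℝ ![w₁, w₂, w₃])
    (hX₁ : z + A w₁ ∈ X) (hX₂ : z + A w₂ ∈ X) (hX₃ : z + A w₃ ∈ X)
    (hd₁ : dist s (z + A w₁) = 1) (hd₂ : dist s (z + A w₂) = 1) (hd₃ : dist s (z + A w₃) = 1) :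
    ∃ w₀ ∈ fccSlots, s = z + A w₀ ∧
      ∀ q ∈ X, dist s q = 1 → ∃ w ∈ fccSlots, q = z + A w₀ + A w := by
  obtain ⟨hBA, w₀, hw₀, hs⟩ := docked_fcc_exact A hz B hall hsz hw₁ hw₂ hw₃ hind hX₁ hX₂ hX₃ hd₁ hd₂ hd₃
  refine ⟨w₀, hw₀, hs, fun q hq hqd => ?_⟩
  obtain ⟨p, hp, hqp⟩ := hall q hq hqd
  have hmem : B p ∈ A '' (↑fccSlots : Set (EuclideanSpace ℝ (Fin 3))) := by
    rw [← hBA]; exact ⟨p, Finset.mem_coe.2 hp, rfl⟩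
  obtain ⟨w, hw, hAw⟩ := hmem
  exact ⟨w, Finset.mem_coe.1 hw, by rw [hqp, ← hAw, hs]⟩

/-! ### §3 The end-ball dichotomy with the CONTACT LIST of the docking ball (the input form of `DockedMenu`) -/

/-- **Payer-or-docked at an end ball, exporting the docking ball's contact list.**  Same hypotheses and conclusion as
`payer_near_or_docked_of_near_endBall`, with the docked branch carrying in addition `hall`: EVERY contact of the docking
ball `s` lies in its dozen `{s + B p : p ∈ P}` — exactly the hypothesis of `docked_fcc_exact` / `docked_hcp_twin` / the named
statement `DockedMenu` (…DockedMenuDefs), so the chain «dichotomy ⇒ docked ⇒ menu» composes by name. -/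
theorem payer_near_or_docked_hall_of_near_endBall {δ : ℝ} (hg : KissingGap δ) (hc : KissingClassification δ)
    (hδ : 5 / 2 ≤ δ) (hX : ∀ p ∈ X, ∀ q ∈ X, p ≠ q → 1 ≤ dist p q)
    {z : EuclideanSpace ℝ (Fin 3)} (hz : z ∈ X) {x : EuclideanSpace ℝ (Fin 3)} (hx : x ∈ X) (hxz : x ≠ z)
    (h3 : dist x z ≤ Real.sqrt 3) :
    (∃ y ∈ X, y ≠ z ∧ dist x y ≤ 2 ∧ (X.filter fun q => dist y q = 1).card ≤ 11) ∨
    ∃ s ∈ X, ∃ (P : Finset (EuclideanSpace ℝ (Fin 3))) (B : EuclideanSpace ℝ (Fin 3) →ₗᵢ[ℝ] EuclideanSpace ℝ (Fin 3)),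
      (P = fccKissingPattern ∨ P = hcpKissingPattern) ∧ dist x s ≤ 1 ∧ dist s z = 1 ∧
      (X.filter fun q => dist s q = 1).card = 12 ∧ (∀ p ∈ P, s + B p ∈ X) ∧
      (∀ q ∈ X, dist s q = 1 → ∃ p ∈ P, q = s + B p) ∧
      (∃ p ∈ P, z = s + B p) ∧ (x = s ∨ ∃ p ∈ P, x = s + B p) := by
  classical
  have hle12 := card_filter_dist_eq_one_le_twelve X hX x
  by_cases h12 : (X.filter fun q => dist x q = 1).card = 12
  swap
  · exact Or.inl ⟨x, hx, hxz, by rw [dist_self]; norm_num, by omega⟩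
  have h1 : 1 ≤ dist x z := hX x hx z hz hxz
  -- all-but-one classification at a twelve-touched ball `s` touching `z`, within `1` of `x`
  have dock : ∀ s ∈ X, dist x s ≤ 1 → dist s z = 1 → (X.filter fun q => dist s q = 1).card = 12 →
      (x = s ∨ dist s x = 1) →
      (∃ y ∈ X, y ≠ z ∧ dist x y ≤ 2 ∧ (X.filter fun q => dist y q = 1).card ≤ 11) ∨
      ∃ s ∈ X, ∃ (P : Finset (EuclideanSpace ℝ (Fin 3))) (B : EuclideanSpace ℝ (Fin 3) →ₗᵢ[ℝ] EuclideanSpace ℝ (Fin 3)),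
        (P = fccKissingPattern ∨ P = hcpKissingPattern) ∧ dist x s ≤ 1 ∧ dist s z = 1 ∧
        (X.filter fun q => dist s q = 1).card = 12 ∧ (∀ p ∈ P, s + B p ∈ X) ∧
        (∀ q ∈ X, dist s q = 1 → ∃ p ∈ P, q = s + B p) ∧
        (∃ p ∈ P, z = s + B p) ∧ (x = s ∨ ∃ p ∈ P, x = s + B p) := by
    intro s hs hxs hsz hs12 hxcase
    by_cases hnb : ∀ y ∈ X, dist s y = 1 → y ≠ z → (X.filter fun q => dist y q = 1).card = 12
    · right
      obtain ⟨P, B, hP, hocc, hall⟩ := exists_frame_of_allButOne hg hc hX hs12 z hnb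
      refine ⟨s, hs, P, B, hP, hxs, hsz, hs12, fun p hp => (hocc p hp).1, hall, hall z hz hsz, ?_⟩
      rcases hxcase with h | h
      · exact Or.inl h
      · exact Or.inr (hall x hx h)
    · left
      push Not at hnb
      obtain ⟨y, hy, hsy, hyz, hy12⟩ := hnb
      have := card_filter_dist_eq_one_le_twelve X hX y
      refine ⟨y, hy, hyz, ?_, by omega⟩
      calc dist x y ≤ dist x s + dist s y := dist_triangle _ _ _
        _ ≤ 2 := by rw [hsy]; linarith
  rcases h1.eq_or_lt with h1 | h1
  · -- contact: `x` itself is the docking ball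
    exact dock x hx (by rw [dist_self]; norm_num) h1.symm h12 (Or.inl rfl)
  · -- non-contact: close-packed shell of `x` or residue rule
    by_cases harr : IsArrangedIn ((fun q => (2 : ℝ) • (q - x)) '' {q | q ∈ X ∧ dist x q = 1}) fccKissingPattern ∨
        IsArrangedIn ((fun q => (2 : ℝ) • (q - x)) '' {q | q ∈ X ∧ dist x q = 1}) hcpKissingPattern
    · obtain ⟨P, B, hP, hB, -⟩ := exists_pattern_frame_of_isArrangedIn harr
      obtain ⟨p, hp, hnear⟩ := exists_dozen_dist_lt_five_fourths hP B x z h3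
      have hsX : x + B p ∈ X := (hB p hp).1
      have hxs : dist x (x + B p) = 1 := (hB p hp).2
      have hsz' : x + B p ≠ z := fun h => (ne_of_gt h1) (by rw [← h, hxs])
      by_cases hs12 : (X.filter fun q => dist (x + B p) q = 1).card = 12
      · have hd1 : dist (x + B p) z = 1 := by
          rcases eq_or_dist_eq_one_or_le_dist_of_saturated hg hX hsX hs12 hz with h | h | h
          · exact absurd h.symm hsz'
          · exact h
          · exfalso; rw [dist_comm] at hnear; linarith
        exact dock (x + B p) hsX hxs.le hd1 hs12 (Or.inr (by rw [dist_comm, hxs]))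
      · left
        have := card_filter_dist_eq_one_le_twelve X hX (x + B p)
        exact ⟨x + B p, hsX, hsz', by rw [hxs]; norm_num, by omega⟩
    · left
      obtain ⟨y, hy, -, -, -, hxy, -, hy12, -⟩ := two_unsaturated_of_not_closePacked hg hc hX h12 harr
      have := card_filter_dist_eq_one_le_twelve X hX y
      exact ⟨y, hy, fun h => (ne_of_gt h1) (by rw [← h, hxy]), by rw [hxy]; norm_num, by omega⟩

end Summit.Ventures.Crystal3D.Theorems

end
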